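import Summits.QuantumFields.YangMills.Theorems.UnitScaleTiltProp8Chart47Analytic
import Summits.QuantumFields.YangMills.Theorems.BalabanUVNodesK0Stub1FlatChartRemainderP
import Summits.QuantumFields.YangMills.Theorems.BalabanUVNodesK0Stub1FlatChartQlinLetters
import Summits.QuantumFields.YangMills.Theorems.BalabanUVNodesK0Stub1FlatHRescaledRowsAtRecord
import Summits.QuantumFields.YangMills.Theorems.BalabanUVNodesN07ChartDOfRecord
import HarnessLib

/-!
# K0⁷ STUB 1 (`stub_prop8StepCoP13`), sub-target S4b ♭ road — **PROP. 3♭ AT THE K0 CARRIER: THE IMPLICIT ♭ CHART `D♭(A′)`**, the (49)–(50) fixed point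
# `C♭(A′ − H♭·D♭(A′)) = D♭(A′)` of the double-bar CONSTRAINT remainder `C♭ := chartLogFlat − D(chartLogFlat)(0)` against the ♭-rescaled flat right inverse `H♭`, with (55)♭,
# uniqueness, analyticity, (48)♭ `chartLogFlat(A′ − H♭D♭(A′)) = D(chartLogFlat)(0)·A′` — THE `Dfun` THE SECT. F W-SLOT SOCKET MUST BE FED (print's (80) `V(A′) = … + V₀(A′ − HD(A′))`),
# replacing the constraint remainder `C♭` itself that FILES 11∕13 (p623337∕p625916) plugged; generic carrier `P` and the record's four-tori, k-UNIFORM window and constants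

Cell `pub-ymgap`, width seat `pub-ymgap-k0-s1-w4` g2 (LOCATED-♭-IMPLICIT-CHART + CLAIM-2 ∕ INTENT-2, bus 2026-08-28T11:13Z).  `--kind proof --supports stmt-QuantumFields-20541 --as helper`;
count-neutral.  [15] = [Balaban1985Variational]; [B7] = [Balaban1985Averaging]; [B6] = [Balaban1984PropagatorsII].

WHY (located, this seat's own lineage).  k0-s1-w2's chart SOCKET (p621022) takes ANY analytic `Dfun` with the (55)-family and builds Sect. F's `W` as the gradient of
`V(A) = ½B(Dfun A, M·Dfun A) − B(QA, M·Dfun A) + V₀(A − H(Dfun A))`; this IS print's (80) exactly when `Dfun = D` = THE (49)–(50) FIXED POINT, the map for which (48)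
«`𝒬(A′ − HD(A′)) = Qlin A′`» holds (p.285: the chart LINEARISES the constraint, so the tangent space (83) is `ker Q`).  The single-bar record instance p612123 feeds
n07-w2's implicit `chartD` (`N07ChartDOfRecord.exists_chartD_of_rightInverse`); the ym3-torus ♭ road feeds `D := Dsel`, the analytic fixed point for `C♭`
(`Chart47AnalyticCarrier`), and uses `C♭` itself only through its (157)♭ column letter in the dressing.  FILES 11∕13 of this seat (and their successors) fed
`Dfun♭ := C♭` — true theorems, but `C♭` fails (48)♭–(49)♭ (`C♭` and `D♭` differ from third order on, print (56)), so the identification of `V` is unavailable for them.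
THIS FILE supplies the right object: `D♭ := Dsel♭`, by the route `UnitScaleTilt`'s CHART-AGNOSTIC engine `Chart47Analytic.exists_analytic_chart47W` (Banach contraction
`B13Contraction113` + complex-analytic IFT `B12LinearizAnalytic267` + Osgood, over ABSTRACT `C`, `H`) fed with this seat's FILE 12′ letters hCd♭∕hCq♭
(`K0Stub1FlatChartRemainderP.chartRemainderFlat_hCd_hCq`: `R⋆♭ = (60800ℓ²L)⁻¹`, `C₂♭ = 64L∕R⋆♭`) and the ♭-rescaled flat `H♭` (kernel `(L^{j(t)}η)⁻¹·(flatH e_t)(b)`; sup row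
`B♭` = FILE 10 `K0Stub1FlatHRescaledRowsAtRecord.rescaledRows_of_adm22_T4`; right inverse of `Qlin♭ = D(chartLogFlat)(0) = (Lʲη)•Q_V` by FILE 9's kernel formula + [B6] (2.35)
`QH = I`, `FlatCubeOperators.QE_hOp`).

WHAT IS PROVED (sorry-free; no definition; axioms standard; fibre `M_N(ℂ)`, `N ≥ 1`).
* §1 (generic `P`, nested `D` with `D.k = k`, (152) weights `K0FlatCubeOpsTextP.IsLevWeight P k D w`, `η = L^{−k}`):
  ★ `bondAvgIter_flatH` ((45) on plain functions: `Q_{j(t)}(flatH Y)(c_t) = Y t`); ★★ `fderiv_chartLogFlat_zero_rescaledFlatH` ((45)♭: for EVERY ℂ-linear `H` with the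
  ♭ kernel, `D(chartLogFlat η D)(0)(H X) = X`); ★★★ `exists_analytic_chartDFlat` — for `Adm22 D R′ M` (`2L ≤ R′`, `1 ≤ M`), EVERY ℂ-linear `H` with a `w₁`∕sup (46) row `B₀`
  (`‖X‖_∞ ≤ t ⇒ w₁(b)‖HX(b)‖ ≤ B₀t`), every radius with `9C₂♭B₀ε < 1`, `3ε ≤ R⋆♭∕4`, `0 < ε`: ONE map `Dsel♭`, `AnalyticOnNhd ℂ` on the `w₁`-ball of radius `ε` with
  `DifferentiableOn ℂ (fderiv ℂ Dsel♭)` there, and at every `A′` of the ball: (55)♭ `‖Dsel♭ A′ c‖ ≤ 4C₂♭ε²`, (49)♭ `C♭(A′ − H(Dsel♭ A′)) = Dsel♭ A′`, UNIQUENESS among small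
  solutions, the sharp (55)♭ `‖Dsel♭ A′ c‖ ≤ 4C₂♭ρ²` for every size bound `ρ`, and (48)♭ `chartLogFlat η D (A′ − H(Dsel♭ A′)) = D(chartLogFlat η D)(0) A′` whenever
  `D(chartLogFlat)(0) ∘ H = id` (the window is inhabited: n07-w2's `N07ChartDOfRecord.exists_eps_chartD`, reused); ★★ `flatChartDSocket` — the Socket binders `hε hCD Dfun h55 hcd` for `Dfun := Dsel♭`,
  `C_D := 4C₂♭` (`ContDiffOn ℂ ω` from analyticity), TOGETHER WITH (49)♭∕(48)♭ — the shape FILE 11∕13's successor (the chart edition of the ♭ W-slot) consumes by `exact`.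
* §2 ★★★ `exists_analytic_chartDFlat_T4` — the record edition: for `F : T4Family`, `N ≥ 1`: `∃ Mh₀ R₀ B♭ ε♭ C_D♭` (`0 ≤ B♭`, `0 < ε♭`, `0 ≤ C_D♭`, BEFORE the family —
  k-UNIFORM, functions of `L` and k0-s1-w3's port constants) such that at every admissible nested family of the record's tori in the standing range, for the (152) weights
  and EVERY ℂ-linear `H` with the ♭ kernel (FILE 13's binder verbatim): the sup row `B♭` of `H`, the right-inverse identity, and `∃ Dsel♭` with ALL of §1's conclusions at
  `ε♭` plus the Socket shape.
HONEST SCOPE.  Instantiation of cited engines (UST `Chart47Analytic`, FILE 12′, FILE 9∕10, `FlatCubeOperators.QE_hOp`) — no new estimate; the (73)♭ letter `θ₀` for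
`𝔇♭ := D(Dsel♭)(A′) = (1 + C♭′H♭)⁻¹C♭′` (print (66)–(68)) is NOT here (sequel (β): k0-s1-w2's `h73t♭` for `C♭′ᵀ` + FILE 8's `h46t` by a Neumann series); whether the
record's (0.4)-constraint IS the ♭ functional (route word (R1′), [B7] (92)∕(97)∕(99)) is NOT asserted; nothing of [15]∕[B7] asserted beyond the engines BY NAME;
`stub_prop8StepCoP13` ∕ K0⁷ NOT closed; N07 NOT discharged; no summit statement is proved by this seat; counts unmoved (28∕28 · 5∕27); one finite 𝕋⁴ programme at
fixed ε — R4 closes the conditional finite-𝕋⁴ rung `BalabanLadder.UV` only, never the summit; the YM mass gap (Clay) is NOT proved by any of this; nothing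
continuum ∕ ℝ⁴ ∕ OS.  No `sorry`, no `def`, no `instance`, no `notation`.

References: [15] (44)–(50) p.285, (53)–(57) p.286, (59)–(63) p.287, Prop. 3 p.289, (80) p.290, (156)–(157) p.302; [B7] Prop. 4 p.38, (125) p.36; [B6] (2.1)–(2.3) p.224,
(2.20) p.226, (2.35) p.228, Cor. 2.8 p.249; [Balaban1987RG1] (0.1) p.251, p.267; [HormanderSCV1973] Thm 2.2.1, 2.2.6.
-/

set_option autoImplicit false

noncomputable section

open scoped BigOperators Matrix.Norms.L2Operator Topology ContDiff
open NormedSpace Metric Set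

namespace Summit.QuantumFields.YangMills.Theorems.K0Stub1FlatChartDImplicit

open Literature.MathematicalPhysics.QuantumFieldTheory.Balaban1983to89
open Literature.MathematicalPhysics.QuantumFieldTheory.Balaban1983to89.T4Continuum (T4Family)
open B6SectADomainsV1 (Domains)
open B6SectAOperatorsV1 (BondIdx QE QsE)
open B6SectAVectorModelV1 (GE EE)
open B6SectA (hOp)
open LatticeFieldCalculus (bondAvgIter)
open Summit.QuantumFields.YangMills.Theorems.FlatCubeOpsText (Adm22)
open Summit.QuantumFields.YangMills.Theorems.K0FlatCubeOpsTextP (IsLevWeight flatH isFlatH_flatH levWeight_nonneg)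
open Summit.QuantumFields.YangMills.Theorems.Prop8ChartDoubleBar (chartLogFlat fderiv_chartLogFlat_zero_apply)
open Summit.QuantumFields.YangMills.Theorems.ChartHInv (bondAvgIter_kernel_apply)
open Summit.QuantumFields.YangMills.Theorems.Chart47Analytic (exists_analytic_chart47W isOpen_wBall)
open Summit.QuantumFields.YangMills.Theorems.K0Stub1FlatChartRemainderP (chartRemainderFlat_hCd_hCq)
open Summit.QuantumFields.YangMills.Theorems.K0Stub1FlatHRescaledRowsAtRecord (rescaledRows_of_adm22_T4)
open Summit.QuantumFields.YangMills.BalabanUVNodes (N07ChartDOfRecord.exists_eps_chartD)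

/-! ## §1  Generic carrier: the right inverse, the implicit ♭ chart, the Socket shape -/

section Generic

variable {P : Params} {N : ℕ} (k : ℕ) (D : Domains P)

/-- ★ **(45) ON PLAIN FUNCTIONS**: `Q_{j(t)}(flatH Y)(c_t) = Y t` — the flat `H = GQ*(QGQ*)⁻¹` of the family is a right inverse of the multi-level straight average on the
index bonds ([B6] (2.35) `QH = I`, `FlatCubeOperators.QE_hOp`, read through `K0FlatCubeOpsTextP.isFlatH_flatH`). [cite: Balaban1985Variational, (45) p.285; Balaban1984PropagatorsII, (2.35) p.228] -/
theorem bondAvgIter_flatH (Y : BondIdx D → ℝ) (t : BondIdx D) : bondAvgIter (t.1.1 : ℕ) (flatH P k D Y) t.1.2 = Y t := by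
  have hfun : (flatH P k D Y : PBond P 0 → ℝ) =
      WithLp.ofLp (hOp (GE D (c := (P.L : ℝ) ^ k) (pow_ne_zero _ (Nat.cast_ne_zero.2 P.L_pos.ne')) (w := fun _ => (1 : ℝ)) (fun _ => one_pos))
        (QsE D) (EE D (c := (P.L : ℝ) ^ k) (pow_ne_zero _ (Nat.cast_ne_zero.2 P.L_pos.ne')) (w := fun _ => (1 : ℝ)) (fun _ => one_pos))
        (WithLp.toLp 2 Y)) := funext fun b => (isFlatH_flatH P k D) Y b
  rw [hfun, ← B6SectAOperatorsV1.QE_apply, FlatCubeOperators.QE_hOp]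

/-- ★★ **(45)♭ — THE ♭-RESCALED FLAT `H` IS A RIGHT INVERSE OF `Qlin♭ = D(chartLogFlat)(0) = (Lʲη)•Q_V`**: for EVERY ℂ-linear `H` with the kernel
`H X b = Σ_t ((L^{j(t)}η)⁻¹·(flatH e_t)(b)) • X t` (`η = L^{−k}`): `fderiv ℂ (chartLogFlat η D) 0 (H X) = X` (FILE 9's kernel form of `Qlin♭` + §1's (45) + UST
`bondAvgIter_kernel_apply`). [cite: Balaban1985Variational, (44)-(45) p.285, (157) p.302; Balaban1985Averaging, (125) p.36; Balaban1984PropagatorsII, (2.35) p.228] -/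
theorem fderiv_chartLogFlat_zero_rescaledFlatH
    (H : (BondIdx D → Matrix (Fin N) (Fin N) ℂ) →ₗ[ℂ] (PBond P 0 → Matrix (Fin N) (Fin N) ℂ))
    (hH : ∀ (X : BondIdx D → Matrix (Fin N) (Fin N) ℂ) (b : PBond P 0), H X b =
      ∑ t, ((((P.L : ℝ) ^ (t.1.1 : ℕ) * (((P.L : ℝ))⁻¹) ^ k)⁻¹ * flatH P k D (Pi.single t 1) b : ℝ) : ℂ) • X t)
    (X : BondIdx D → Matrix (Fin N) (Fin N) ℂ) :
    fderiv ℂ (chartLogFlat (((P.L : ℝ)⁻¹) ^ k) D : (PBond P 0 → Matrix (Fin N) (Fin N) ℂ) → BondIdx D → Matrix (Fin N) (Fin N) ℂ) 0 (H X) = X := by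
  classical
  have hL0 : (0 : ℝ) < (P.L : ℝ) := by exact_mod_cast P.L_pos
  have hlam : ∀ t : BondIdx D, (P.L : ℝ) ^ (t.1.1 : ℕ) * ((P.L : ℝ)⁻¹) ^ k ≠ 0 := fun t => by positivity
  -- the real kernel with the level factor
  set Ks : PBond P 0 → BondIdx D → ℝ := fun b s => ((P.L : ℝ) ^ (s.1.1 : ℕ) * ((P.L : ℝ)⁻¹) ^ k)⁻¹ * flatH P k D (Pi.single s 1) b with hKs
  have hHX : (H X : PBond P 0 → Matrix (Fin N) (Fin N) ℂ) = fun b => ∑ s, Ks b s • X s := by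
    funext b
    rw [hH X b]
    exact Finset.sum_congr rfl fun s _ => by rw [Complex.coe_smul]
  funext t
  rw [fderiv_chartLogFlat_zero_apply, hHX, bondAvgIter_kernel_apply Ks X (t.1.1 : ℕ) t.1.2, Finset.smul_sum]
  have hker : ∀ s : BondIdx D, bondAvgIter (t.1.1 : ℕ) (fun b => Ks b s) t.1.2 =
      ((P.L : ℝ) ^ (s.1.1 : ℕ) * ((P.L : ℝ)⁻¹) ^ k)⁻¹ * (Pi.single s (1 : ℝ) : BondIdx D → ℝ) t := by
    intro s
    have hsc : (fun b => Ks b s) = flatH P k D ((((P.L : ℝ) ^ (s.1.1 : ℕ) * ((P.L : ℝ)⁻¹) ^ k)⁻¹) • (Pi.single s (1 : ℝ) : BondIdx D → ℝ)) := by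
      funext b; simp only [hKs, map_smul, Pi.smul_apply, smul_eq_mul]
    rw [hsc, bondAvgIter_flatH k D _ t, Pi.smul_apply, smul_eq_mul]
  simp_rw [hker]
  rw [Finset.sum_eq_single t (fun s _ hs => by rw [Pi.single_eq_of_ne (Ne.symm hs), mul_zero, zero_smul, smul_zero])
    (fun h => absurd (Finset.mem_univ t) h), Pi.single_eq_same, mul_one, ← Complex.coe_smul, smul_smul]
  have hscal : ((((P.L : ℝ)⁻¹) ^ k : ℝ) : ℂ) * ((P.L : ℕ) : ℂ) ^ (t.1.1 : ℕ) *
      ((((P.L : ℝ) ^ (t.1.1 : ℕ) * ((P.L : ℝ)⁻¹) ^ k)⁻¹ : ℝ) : ℂ) = 1 := by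
    have hLc : ((P.L : ℕ) : ℂ) ≠ 0 := Nat.cast_ne_zero.2 P.L_pos.ne'
    push_cast
    field_simp
  rw [hscal, one_smul]

/-- ★★★ **PROP. 3♭ — THE IMPLICIT ♭ CHART AT A GENERIC CARRIER** (see the module docstring): for a nested family `D` of top level `k`, admissible `Adm22 D R′ M` with `2L ≤ R′`,
`1 ≤ M`, the (152) weights `w`, EVERY ℂ-linear `H` with the sup (46) row `B₀ ≥ 0` in the `w₁`∕`‖·‖_∞` currency, and every radius `ε` with `9C₂♭B₀ε < 1`, `3ε ≤ R⋆♭∕4`,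
`0 < ε` (`R⋆♭ = (60800ℓ²L)⁻¹`, `C₂♭ = 64L∕R⋆♭`, `ℓ = (d+2)L`): THERE IS ONE map `Dsel♭` — analytic on the open `w₁`-ball of radius `ε`, with holomorphic derivative —
such that at every `A′` of the ball: (55)♭ `‖Dsel♭ A′ c‖ ≤ 4C₂♭ε²`; (49)♭ `C♭(A′ − H(Dsel♭A′)) = Dsel♭A′` for `C♭ := chartLogFlat η D − D(chartLogFlat η D)(0)`; uniqueness
among solutions of that size; the sharp (55)♭ `‖Dsel♭ A′ c‖ ≤ 4C₂♭ρ²` for every size bound `ρ ≥ 0` of `A′`; and (48)♭ `chartLogFlat η D (A′ − H(Dsel♭ A′)) = D(chartLogFlat η D)(0) A′`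
provided `D(chartLogFlat η D)(0) ∘ H = id` — UST `Chart47Analytic.exists_analytic_chart47W` at the K0 carrier fed with FILE 12′'s hCd♭∕hCq♭.
[cite: Balaban1985Variational, (44)-(50) p.285, (53)-(57) p.286, Prop. 3 p.289, (157) p.302; Balaban1985Averaging, Prop. 4 p.38; Balaban1987RG1, p.267; HormanderSCV1973, Thm 2.2.6] -/
theorem exists_analytic_chartDFlat [NeZero N] {R' M : ℕ} (hR'L : 2 * P.L ≤ R') (hM : 1 ≤ M) (hDk : D.k = k) (hAdm : Adm22 D R' M)
    {w : ℕ → PBond P 0 → ℝ} (hw : IsLevWeight P k D w)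
    (H : (BondIdx D → Matrix (Fin N) (Fin N) ℂ) →ₗ[ℂ] (PBond P 0 → Matrix (Fin N) (Fin N) ℂ)) {B₀ : ℝ} (hB₀ : 0 ≤ B₀)
    (hHB : ∀ (X : BondIdx D → Matrix (Fin N) (Fin N) ℂ) (t : ℝ), 0 ≤ t → (∀ c, ‖X c‖ ≤ t) → ∀ b, w 1 b * ‖H X b‖ ≤ B₀ * t)
    {ε : ℝ}
    (hq : 9 * (64 * (P.L : ℝ) / (60800 * (((P.d + 2) * P.L : ℕ) : ℝ) ^ 2 * (P.L : ℝ))⁻¹) * B₀ * ε < 1)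
    (h3ε : 3 * ε ≤ (60800 * (((P.d + 2) * P.L : ℕ) : ℝ) ^ 2 * (P.L : ℝ))⁻¹ / 4) (hε : 0 < ε) :
    ∃ Dsel : (PBond P 0 → Matrix (Fin N) (Fin N) ℂ) → (BondIdx D → Matrix (Fin N) (Fin N) ℂ),
      AnalyticOnNhd ℂ Dsel {A' : PBond P 0 → Matrix (Fin N) (Fin N) ℂ | ∀ b, w 1 b * ‖A' b‖ < ε} ∧
      DifferentiableOn ℂ (fderiv ℂ Dsel) {A' : PBond P 0 → Matrix (Fin N) (Fin N) ℂ | ∀ b, w 1 b * ‖A' b‖ < ε} ∧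
      ∀ A' : PBond P 0 → Matrix (Fin N) (Fin N) ℂ, (∀ b, w 1 b * ‖A' b‖ < ε) →
        (∀ c, ‖Dsel A' c‖ ≤ 4 * (64 * (P.L : ℝ) / (60800 * (((P.d + 2) * P.L : ℕ) : ℝ) ^ 2 * (P.L : ℝ))⁻¹) * ε ^ 2) ∧
        (chartLogFlat (((P.L : ℝ)⁻¹) ^ k) D (A' - H (Dsel A')) -
            (fderiv ℂ (chartLogFlat (((P.L : ℝ)⁻¹) ^ k) D : (PBond P 0 → Matrix (Fin N) (Fin N) ℂ) → BondIdx D → Matrix (Fin N) (Fin N) ℂ) 0) (A' - H (Dsel A'))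
          = Dsel A') ∧
        (∀ D' : BondIdx D → Matrix (Fin N) (Fin N) ℂ,
          (∀ c, ‖D' c‖ ≤ 4 * (64 * (P.L : ℝ) / (60800 * (((P.d + 2) * P.L : ℕ) : ℝ) ^ 2 * (P.L : ℝ))⁻¹) * ε ^ 2) →
          chartLogFlat (((P.L : ℝ)⁻¹) ^ k) D (A' - H D') -
              (fderiv ℂ (chartLogFlat (((P.L : ℝ)⁻¹) ^ k) D : (PBond P 0 → Matrix (Fin N) (Fin N) ℂ) → BondIdx D → Matrix (Fin N) (Fin N) ℂ) 0) (A' - H D') = D' →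
          D' = Dsel A') ∧
        (∀ ρ : ℝ, 0 ≤ ρ → (∀ b, w 1 b * ‖A' b‖ ≤ ρ) →
          ∀ c, ‖Dsel A' c‖ ≤ 4 * (64 * (P.L : ℝ) / (60800 * (((P.d + 2) * P.L : ℕ) : ℝ) ^ 2 * (P.L : ℝ))⁻¹) * ρ ^ 2) ∧
        ((∀ X, (fderiv ℂ (chartLogFlat (((P.L : ℝ)⁻¹) ^ k) D : (PBond P 0 → Matrix (Fin N) (Fin N) ℂ) → BondIdx D → Matrix (Fin N) (Fin N) ℂ) 0) (H X) = X) →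
          chartLogFlat (((P.L : ℝ)⁻¹) ^ k) D (A' - H (Dsel A')) =
            (fderiv ℂ (chartLogFlat (((P.L : ℝ)⁻¹) ^ k) D : (PBond P 0 → Matrix (Fin N) (Fin N) ℂ) → BondIdx D → Matrix (Fin N) (Fin N) ℂ) 0) A') := by
  classical
  set Rs : ℝ := (60800 * (((P.d + 2) * P.L : ℕ) : ℝ) ^ 2 * (P.L : ℝ))⁻¹ with hRs
  set C₂ : ℝ := 64 * (P.L : ℝ) / Rs with hC₂
  set η : ℝ := ((P.L : ℝ)⁻¹) ^ k with hη
  -- the ♭ constraint remainder and the linearisation, as maps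
  set Qlin : (PBond P 0 → Matrix (Fin N) (Fin N) ℂ) →L[ℂ] (BondIdx D → Matrix (Fin N) (Fin N) ℂ) :=
    fderiv ℂ (chartLogFlat η D : (PBond P 0 → Matrix (Fin N) (Fin N) ℂ) → BondIdx D → Matrix (Fin N) (Fin N) ℂ) 0 with hQlin
  set C : (PBond P 0 → Matrix (Fin N) (Fin N) ℂ) → (BondIdx D → Matrix (Fin N) (Fin N) ℂ) :=
    fun A => chartLogFlat η D A - Qlin A with hCdef
  have hL1 : (1 : ℝ) ≤ P.L := by exact_mod_cast P.L_pos
  have hℓ1 : (1 : ℝ) ≤ (((P.d + 2) * P.L : ℕ) : ℝ) := by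
    exact_mod_cast Nat.one_le_iff_ne_zero.mpr (Nat.mul_ne_zero (by omega) (by have := P.hL.2; omega))
  have hden : 0 < 60800 * (((P.d + 2) * P.L : ℕ) : ℝ) ^ 2 * (P.L : ℝ) := by positivity
  have hRs0 : 0 < Rs := inv_pos.mpr hden
  have hC₂0 : 0 ≤ C₂ := div_nonneg (by positivity) hRs0.le
  have hw1pos : ∀ b : PBond P 0, 0 < w 1 b := fun b => by rw [hw 1 b, pow_one]; positivity
  -- FILE 12′: hCd♭ and hCq♭ on the `w₁`-ball of radius `R⋆♭∕4`
  obtain ⟨hdiff, hquad⟩ := chartRemainderFlat_hCd_hCq (𝔸 := Matrix (Fin N) (Fin N) ℂ) k hR'L hM D hDk hAdm hw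
  have hCq : ∀ (Y : PBond P 0 → Matrix (Fin N) (Fin N) ℂ) (r : ℝ), r < Rs / 4 → (∀ b, w 1 b * ‖Y b‖ ≤ r) →
      ∀ c : BondIdx D, (fun _ : BondIdx D => (1 : ℝ)) c * ‖C Y c‖ ≤ C₂ * r ^ 2 := by
    intro Y r hr hY c
    rw [one_mul]
    exact hquad Y r hr hY c
  have hCd : DifferentiableOn ℂ C {Y : PBond P 0 → Matrix (Fin N) (Fin N) ℂ | ∀ b, w 1 b * ‖Y b‖ < Rs / 4} :=
    hdiff.sub Qlin.differentiable.differentiableOn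
  have hHw : ∀ (X : BondIdx D → Matrix (Fin N) (Fin N) ℂ) (t : ℝ), 0 ≤ t → (∀ c, (fun _ : BondIdx D => (1 : ℝ)) c * ‖X c‖ ≤ t) →
      ∀ b, w 1 b * ‖H X b‖ ≤ B₀ * t := by
    intro X t ht hX b
    exact hHB X t ht (fun c => by simpa only [one_mul] using hX c) b
  obtain ⟨Dsel, han, hdf, hspec⟩ := exists_analytic_chart47W (ι := PBond P 0) (β := BondIdx D) (V := Matrix (Fin N) (Fin N) ℂ)
    (w₀ := w 1) (wB := fun _ => (1 : ℝ)) hw1pos (fun _ => one_pos) C H hC₂0 hB₀ hHw hCq hCd hq h3ε hε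
  refine ⟨Dsel, han, hdf, fun A' hA' => ?_⟩
  obtain ⟨⟨hball, hfix⟩, huniq, hsharp, h48⟩ := hspec A' hA'
  refine ⟨fun c => by simpa only [one_mul] using hball c, hfix, fun D' hD' hD'fix => huniq D' (fun c => by rw [one_mul]; exact hD' c) hD'fix,
    fun ρ hρ hA'ρ c => by simpa only [one_mul] using hsharp ρ hρ hA'ρ c, fun hinv => ?_⟩
  have h := h48 (Qlin : (PBond P 0 → Matrix (Fin N) (Fin N) ℂ) →ₗ[ℂ] (BondIdx D → Matrix (Fin N) (Fin N) ℂ)) (fun X => hinv X)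
  -- `Qlin Φ + (chartLogFlat Φ − Qlin Φ) = chartLogFlat Φ`
  have hsum : (Qlin : (PBond P 0 → Matrix (Fin N) (Fin N) ℂ) →ₗ[ℂ] (BondIdx D → Matrix (Fin N) (Fin N) ℂ)) (A' - H (Dsel A')) + C (A' - H (Dsel A')) =
      chartLogFlat η D (A' - H (Dsel A')) := by
    simp only [hCdef, ContinuousLinearMap.coe_coe]
    abel
  rw [hsum] at h
  exact h

/-- ★★ **THE SOCKET SHAPE FOR `Dfun := Dsel♭`** — under §1's hypotheses the implicit ♭ chart delivers EXACTLY the chart binders of k0-s1-w2's Socket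
(`K0Stub1SectFWSlotAtRecordSocket.exists_sectF_W_atRecord_of_chartSocket(_O1)`) — `0 < ε`, `0 ≤ C_D` (`C_D := 4C₂♭`), the (55) letter
`(∀ b, w₁(b)‖A′ b‖ < ε) → ∀ ρ′ ≥ 0, (∀ b, w₁(b)‖A′ b‖ ≤ ρ′) → ∀ i, ‖Dsel♭ A′ i‖ ≤ C_D·ρ′²`, `ContDiffOn ℂ ω Dsel♭` on the open ball — TOGETHER WITH what the constraint
remainder `C♭` could not give: (49)♭ and (48)♭ at every point of the ball (the chart LINEARISES the ♭ constraint: `chartLogFlat(A′ − H(Dsel♭A′)) = Qlin♭A′`).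
[cite: Balaban1985Variational, (47)-(49) p.285, (55) p.286, Prop. 3 p.289, (80) p.290, (157) p.302] -/
theorem flatChartDSocket [NeZero N] {R' M : ℕ} (hR'L : 2 * P.L ≤ R') (hM : 1 ≤ M) (hDk : D.k = k) (hAdm : Adm22 D R' M)
    {w : ℕ → PBond P 0 → ℝ} (hw : IsLevWeight P k D w)
    (H : (BondIdx D → Matrix (Fin N) (Fin N) ℂ) →ₗ[ℂ] (PBond P 0 → Matrix (Fin N) (Fin N) ℂ)) {B₀ : ℝ} (hB₀ : 0 ≤ B₀)
    (hHB : ∀ (X : BondIdx D → Matrix (Fin N) (Fin N) ℂ) (t : ℝ), 0 ≤ t → (∀ c, ‖X c‖ ≤ t) → ∀ b, w 1 b * ‖H X b‖ ≤ B₀ * t)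
    (hinv : ∀ X, (fderiv ℂ (chartLogFlat (((P.L : ℝ)⁻¹) ^ k) D : (PBond P 0 → Matrix (Fin N) (Fin N) ℂ) → BondIdx D → Matrix (Fin N) (Fin N) ℂ) 0) (H X) = X)
    {ε : ℝ}
    (hq : 9 * (64 * (P.L : ℝ) / (60800 * (((P.d + 2) * P.L : ℕ) : ℝ) ^ 2 * (P.L : ℝ))⁻¹) * B₀ * ε < 1)
    (h3ε : 3 * ε ≤ (60800 * (((P.d + 2) * P.L : ℕ) : ℝ) ^ 2 * (P.L : ℝ))⁻¹ / 4) (hε : 0 < ε) :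
    ∃ Dsel : (PBond P 0 → Matrix (Fin N) (Fin N) ℂ) → (BondIdx D → Matrix (Fin N) (Fin N) ℂ),
      0 < ε ∧ 0 ≤ 4 * (64 * (P.L : ℝ) / (60800 * (((P.d + 2) * P.L : ℕ) : ℝ) ^ 2 * (P.L : ℝ))⁻¹) ∧
      (∀ A' : PBond P 0 → Matrix (Fin N) (Fin N) ℂ, (∀ b, w 1 b * ‖A' b‖ < ε) →
        ∀ ρ' : ℝ, 0 ≤ ρ' → (∀ b, w 1 b * ‖A' b‖ ≤ ρ') →
          ∀ i : BondIdx D, ‖Dsel A' i‖ ≤ (4 * (64 * (P.L : ℝ) / (60800 * (((P.d + 2) * P.L : ℕ) : ℝ) ^ 2 * (P.L : ℝ))⁻¹)) * ρ' ^ 2) ∧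
      ContDiffOn ℂ ω Dsel {Y : PBond P 0 → Matrix (Fin N) (Fin N) ℂ | ∀ b, w 1 b * ‖Y b‖ < ε} ∧
      (∀ A' : PBond P 0 → Matrix (Fin N) (Fin N) ℂ, (∀ b, w 1 b * ‖A' b‖ < ε) →
        chartLogFlat (((P.L : ℝ)⁻¹) ^ k) D (A' - H (Dsel A')) -
            (fderiv ℂ (chartLogFlat (((P.L : ℝ)⁻¹) ^ k) D : (PBond P 0 → Matrix (Fin N) (Fin N) ℂ) → BondIdx D → Matrix (Fin N) (Fin N) ℂ) 0) (A' - H (Dsel A'))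
          = Dsel A' ∧
        chartLogFlat (((P.L : ℝ)⁻¹) ^ k) D (A' - H (Dsel A')) =
          (fderiv ℂ (chartLogFlat (((P.L : ℝ)⁻¹) ^ k) D : (PBond P 0 → Matrix (Fin N) (Fin N) ℂ) → BondIdx D → Matrix (Fin N) (Fin N) ℂ) 0) A') := by
  have hL1 : (1 : ℝ) ≤ P.L := by exact_mod_cast P.L_pos
  have hℓ1 : (1 : ℝ) ≤ (((P.d + 2) * P.L : ℕ) : ℝ) := by
    exact_mod_cast Nat.one_le_iff_ne_zero.mpr (Nat.mul_ne_zero (by omega) (by have := P.hL.2; omega))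
  have hden : 0 < 60800 * (((P.d + 2) * P.L : ℕ) : ℝ) ^ 2 * (P.L : ℝ) := by positivity
  have hRs0 : 0 < (60800 * (((P.d + 2) * P.L : ℕ) : ℝ) ^ 2 * (P.L : ℝ))⁻¹ := inv_pos.mpr hden
  have hC0 : 0 ≤ 4 * (64 * (P.L : ℝ) / (60800 * (((P.d + 2) * P.L : ℕ) : ℝ) ^ 2 * (P.L : ℝ))⁻¹) :=
    mul_nonneg (by norm_num) (div_nonneg (by positivity) hRs0.le)
  obtain ⟨Dsel, han, -, hspec⟩ := exists_analytic_chartDFlat (k := k) (D := D) hR'L hM hDk hAdm hw H hB₀ hHB hq h3ε hε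
  refine ⟨Dsel, hε, hC0, fun A' hA' ρ' hρ' hA'ρ i => (hspec A' hA').2.2.2.1 ρ' hρ' hA'ρ i, han.contDiffOn_of_completeSpace,
    fun A' hA' => ⟨(hspec A' hA').2.1, (hspec A' hA').2.2.2.2 hinv⟩⟩

end Generic

/-! ## §2  The record edition: the implicit ♭ chart at every admissible family of NODE 00's four-tori, k-UNIFORM -/

section Record

/-- ★★★ **PROP. 3♭ AT THE RECORD, k-UNIFORM** — for every `F : T4Family` and `N ≥ 1` there are thresholds `Mh₀ R₀` and constants `B♭ ≥ 0`, `ε♭ > 0`, `C_D♭ ≥ 0` (functions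
of `L` and k0-s1-w3's port constants only, quantified BEFORE the family) such that at every admissible nested family of the record's tori in the standing range
(`1 ≤ K − n`, `K − n + 1 ≤ m + K`, `M_h = L^{a′} ≥ Mh₀`, `R ≥ R₀`, `a′ + 3 ≤ m + n`, `D.k = K − n`, `Adm22 D R (L·M_h)`), for the (152) weights and EVERY ℂ-linear `H` with
the ♭ kernel `(L^{j(t)}η)⁻¹·(flatH e_t)(b)` (FILE 13's binder verbatim): (i) the sup (46) row `‖X‖_∞ ≤ t ⇒ w₁(b)‖HX(b)‖ ≤ B♭·t` (FILE 10); (ii) the right-inverse identity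
`D(chartLogFlat)(0)(HX) = X` (§1); (iii) `∃ Dsel♭` with the Socket shape at (`ε♭`, `C_D♭`) — (55)♭, `ContDiffOn ℂ ω` — AND (49)♭, (48)♭ at every point of the `ε♭`-ball.
[cite: Balaban1985Variational, (44)-(50) p.285, (55) p.286, Prop. 3 p.289, (157) p.302; Balaban1984PropagatorsII, (2.35) p.228, Cor. 2.8 p.249; Balaban1987RG1, (0.1) p.251] -/
theorem exists_analytic_chartDFlat_T4 (N : ℕ) [NeZero N] (F : T4Family) :
    ∃ (Mh₀ R₀ : ℕ) (Bf ε CD : ℝ), 0 ≤ Bf ∧ 0 < ε ∧ 0 ≤ CD ∧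
    ∀ (n K : ℕ) (_ : 1 ≤ K - n) (_ : K - n + 1 ≤ F.m + K) {Mh R a' : ℕ} (_ : Mh = F.L ^ a') (_ : Mh₀ ≤ Mh) (_ : R₀ ≤ R)
      (_ : a' + 3 ≤ F.m + n) (D : Domains (F.P K)) (_ : D.k = K - n) (_ : Adm22 D R (F.L * Mh))
      (w : ℕ → PBond (F.P K) 0 → ℝ) (_ : IsLevWeight (F.P K) (K - n) D w)
      (H : (BondIdx D → Matrix (Fin N) (Fin N) ℂ) →ₗ[ℂ] (PBond (F.P K) 0 → Matrix (Fin N) (Fin N) ℂ))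
      (_ : ∀ (X : BondIdx D → Matrix (Fin N) (Fin N) ℂ) (b : PBond (F.P K) 0), H X b =
        ∑ t, (((((F.P K).L : ℝ) ^ (t.1.1 : ℕ) * ((((F.P K).L : ℝ))⁻¹) ^ (K - n))⁻¹ * flatH (F.P K) (K - n) D (Pi.single t 1) b : ℝ) : ℂ) • X t),
      (∀ (X : BondIdx D → Matrix (Fin N) (Fin N) ℂ) (t : ℝ), 0 ≤ t → (∀ c, ‖X c‖ ≤ t) → ∀ b, w 1 b * ‖H X b‖ ≤ Bf * t) ∧
      (∀ X, (fderiv ℂ (chartLogFlat ((((F.P K).L : ℝ)⁻¹) ^ (K - n)) D :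
          (PBond (F.P K) 0 → Matrix (Fin N) (Fin N) ℂ) → BondIdx D → Matrix (Fin N) (Fin N) ℂ) 0) (H X) = X) ∧
      ∃ Dsel : (PBond (F.P K) 0 → Matrix (Fin N) (Fin N) ℂ) → (BondIdx D → Matrix (Fin N) (Fin N) ℂ),
        (∀ A' : PBond (F.P K) 0 → Matrix (Fin N) (Fin N) ℂ, (∀ b, w 1 b * ‖A' b‖ < ε) →
          ∀ ρ' : ℝ, 0 ≤ ρ' → (∀ b, w 1 b * ‖A' b‖ ≤ ρ') → ∀ i : BondIdx D, ‖Dsel A' i‖ ≤ CD * ρ' ^ 2) ∧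
        ContDiffOn ℂ ω Dsel {Y : PBond (F.P K) 0 → Matrix (Fin N) (Fin N) ℂ | ∀ b, w 1 b * ‖Y b‖ < ε} ∧
        (∀ A' : PBond (F.P K) 0 → Matrix (Fin N) (Fin N) ℂ, (∀ b, w 1 b * ‖A' b‖ < ε) →
          chartLogFlat ((((F.P K).L : ℝ)⁻¹) ^ (K - n)) D (A' - H (Dsel A')) -
              (fderiv ℂ (chartLogFlat ((((F.P K).L : ℝ)⁻¹) ^ (K - n)) D :
                (PBond (F.P K) 0 → Matrix (Fin N) (Fin N) ℂ) → BondIdx D → Matrix (Fin N) (Fin N) ℂ) 0) (A' - H (Dsel A')) = Dsel A' ∧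
          chartLogFlat ((((F.P K).L : ℝ)⁻¹) ^ (K - n)) D (A' - H (Dsel A')) =
            (fderiv ℂ (chartLogFlat ((((F.P K).L : ℝ)⁻¹) ^ (K - n)) D :
              (PBond (F.P K) 0 → Matrix (Fin N) (Fin N) ℂ) → BondIdx D → Matrix (Fin N) (Fin N) ℂ) 0) A') := by
  classical
  -- FILE 10: the sup row `B♭` of every ♭-rescaled flat `H`
  obtain ⟨Mh₀, R₀, Bf, hBf, hrows⟩ := rescaledRows_of_adm22_T4 F
  -- the k-uniform constants `R⋆♭`, `C₂♭`, the window `ε♭`, `C_D♭ = 4C₂♭`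
  set Rs : ℝ := (60800 * ((((4 : ℕ) + 2) * F.L : ℕ) : ℝ) ^ 2 * (F.L : ℝ))⁻¹ with hRs
  have hL1 : (1 : ℝ) ≤ F.L := by exact_mod_cast F.hL.2.le
  have hℓ1 : (1 : ℝ) ≤ ((((4 : ℕ) + 2) * F.L : ℕ) : ℝ) := by
    exact_mod_cast Nat.one_le_iff_ne_zero.mpr (Nat.mul_ne_zero (by omega) (by have := F.hL.2; omega))
  have hden : 0 < 60800 * ((((4 : ℕ) + 2) * F.L : ℕ) : ℝ) ^ 2 * (F.L : ℝ) := by positivity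
  have hRs0 : 0 < Rs := inv_pos.mpr hden
  have hC₂0 : 0 ≤ 64 * (F.L : ℝ) / Rs := div_nonneg (by positivity) hRs0.le
  obtain ⟨ε, hε, hq, h3ε⟩ := N07ChartDOfRecord.exists_eps_chartD hC₂0 hBf (by positivity : 0 < Rs / 4)
  refine ⟨Mh₀, max R₀ (2 * F.L), Bf, ε, 4 * (64 * (F.L : ℝ) / Rs), hBf, hε, mul_nonneg (by norm_num) hC₂0, ?_⟩
  intro n K hk1 hk' Mh R a' hMha hMh hR hsize D hDk hAdm w hw H hH
  have hR₀ : R₀ ≤ R := le_trans (le_max_left _ _) hR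
  have hRL : 2 * (F.P K).L ≤ R := le_trans (le_max_right _ _) hR
  have hMh1 : 1 ≤ Mh := by rw [hMha]; exact Nat.one_le_pow _ _ (F.P K).L_pos
  have hM1 : 1 ≤ F.L * Mh := Nat.mul_pos (F.P K).L_pos (by omega)
  -- (i) the sup row from FILE 10 at `ν_t := (L^{j(t)}η)⁻¹` (the bound is met with equality)
  have hν : ∀ t : BondIdx D, |(((F.P K).L : ℝ) ^ (t.1.1 : ℕ) * ((((F.P K).L : ℝ))⁻¹) ^ (K - n))⁻¹| ≤
      (((F.P K).L : ℝ) ^ (t.1.1 : ℕ) * ((((F.P K).L : ℝ))⁻¹) ^ (K - n))⁻¹ := fun t => by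
    have hL0 : (0 : ℝ) < ((F.P K).L : ℝ) := by exact_mod_cast (F.P K).L_pos
    rw [abs_of_pos (by positivity)]
  obtain ⟨hHB, -⟩ := hrows n K hk1 hk' hMha hMh hR₀ hsize D hDk hAdm w hw (𝔸 := Matrix (Fin N) (Fin N) ℂ)
    (fun t => (((F.P K).L : ℝ) ^ (t.1.1 : ℕ) * ((((F.P K).L : ℝ))⁻¹) ^ (K - n))⁻¹) hν H hH
  -- (ii) the right-inverse identity
  have hinv := fderiv_chartLogFlat_zero_rescaledFlatH (k := K - n) (D := D) H hH
  refine ⟨hHB, hinv, ?_⟩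
  -- (iii) the implicit chart in the Socket shape
  obtain ⟨Dsel, -, -, h55, hcd, hfix⟩ := flatChartDSocket (N := N) (k := K - n) (D := D) hRL hM1 hDk hAdm hw H hBf hHB hinv
    (ε := ε) (by simpa only [T4Family.P_L, T4Family.P_d] using hq) (by simpa only [T4Family.P_L, T4Family.P_d] using h3ε) hε
  refine ⟨Dsel, fun A' hA' ρ' hρ' hA'ρ i => ?_, hcd, hfix⟩
  have h := h55 A' hA' ρ' hρ' hA'ρ i
  simpa only [T4Family.P_L, T4Family.P_d] using h

end Record

end Summit.QuantumFields.YangMills.Theorems.K0Stub1FlatChartDImplicit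

end
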